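import Literature.Topology.FourManifolds.BallRemovalCobordism
import Literature.Topology.FourManifolds.HomotopySpheresInverseHomotopy
import Literature.Topology.FourManifolds.CollarTheorem
import Literature.AlgebraicTopology.SingularHomology.AcyclicPuncture
import Literature.AlgebraicTopology.SingularHomology.OrientationCover
import Literature.AlgebraicTopology.SingularHomology.CollapseMap
import Literature.AlgebraicTopology.SingularHomology.ExcisionMayerVietorisProofs
import Literature.AlgebraicTopology.Homotopy.CollarPush
import Literature.AlgebraicTopology.Homotopy.WhiteheadTheorem
import Literature.AlgebraicTopology.Homotopy.WhiteheadContractibleLeaves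
import Literature.AlgebraicTopology.FundamentalGroupoid.SimplyConnectedComplPoint
import Mathlib.RingTheory.Noetherian.Orzech
import HarnessLib

/-!
# The ball-removal cobordism of an acyclic simply connected bounding manifold is an h-cobordism

Topic `Literature/Topology/FourManifolds`. Kervaire–Milnor, *Groups of homotopy spheres I*,
Ann. of Math. 77 (1963), proof of Lemma 2.3 (p. 506): for `M = bW'` with `W'` contractible,
"removing the interior of an imbedded disk we obtain a simply connected manifold `W` with
`bW = M + (-Sⁿ)` … the inclusion `Sⁿ → W` induces a homology isomorphism; hence `Sⁿ` is a
deformation retract of `W` … the inclusion `M → W` also induces isomorphisms of homology groups.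
Since `M` is simply connected, this completes the proof."

**What is new here, relative to the tree.** `HomotopySpheresInverseHomotopy.lean` already reduces
the homotopy half of Lemma 2.3 (both ends of the ball-removal cobordism `(W' ∖ i(B̊); M, 𝕊ⁿ)` of
`BallRemovalCobordism.lean` are homotopy equivalences, for EVERY closed simply connected `M` bounding
a contractible `W'`) to named facts: Whitehead's theorem
(`Literature.AlgebraicTopology.Homotopy.whitehead_exists_homotopyEquiv`, Hatcher Cor. 4.33), two
CW-type facts, and the "Poincaré duality step" `NullCobordism.isIso_singularHomology_map_inclToComplCenter`
(`M → W' ∖ {i 0}` is a homology isomorphism), itself derived in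
`NullCobordismBoundaryHomology.lean` from the vendored Lefschetz duality facts of
`Literature/AlgebraicTopology/SingularHomology/LefschetzDuality.lean` (named facts, not proved); see
`NullCobordism.isHomotopyEquiv_compl_ball_of_contractibleSpace_of_facts` (six leaves) and
`isHCobordant_sphere_of_boundsContractible_of_whitehead`. This file obtains the same conclusion for
the SUBCLASS where `M : Type` is a simply connected integral homology `(m+1)`-sphere (`m ≥ 1`) and
`W'` is simply connected with `Hₖ(W'; ℤ) = 0` for `k ≥ 1` (acyclic; contractibility is not needed),
from only TWO leaves — `whitehead_exists_homotopyEquiv` and the CW homotopy type of manifolds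
`Literature.AlgebraicTopology.Homotopy.Manifold.exists_cwComplex_homotopyEquiv` (Milnor 1959,
Cor. 1) — by PROVING the duality step for this subclass (`isIso_map_inclToComplCenter`): the
interior `X` of `W'` is a simply connected, hence `ℤ`-oriented (Hatcher Prop. 3.25), topological
`(m+2)`-manifold with `Hₘ₊₁(X) = Hₘ₊₂(X) = 0`, and for the compact core `K = W' ∖` (open collar of
`M`) the inclusion of `X ∖ K ≃ M` into `X ∖ {c} ≃ W' ∖ i(B̊)` is onto `Hₘ₊₁ ≅ ℤ` by the orientation
class of `K` (`Literature.AlgebraicTopology.SingularHomology.HomologicalOrientation.map_compl_surjective`,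
`AcyclicPuncture.lean`), hence an isomorphism (a surjection `ℤ → ℤ`). This subclass is the one met by
Kervaire–Milnor's Lemma 2.4 (`M = Σ # (-Σ)` a homotopy sphere, `W'` the rotation body), see
`RotationBodyHCobordism.lean`. The homotopy-theoretic book-keeping (interior and cores of a collared
manifold, `CollarPush.lean`; `K ≃ₕ W' ∖ {i 0}`, `BallRemovalData.homotopyEquivComplCenter`) is the
tree's.

## Main results

* `NullCobordism.exists_boundaryCollar`: a topological collar `M × [0, 1] → W'` of `∂W' = M`
  (from the smooth collar theorem `BoundaryData.nonempty_collar_of_compactSpace`).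
* `isIso_singularHomology_map_sphereToComplCenter_of_isZero`: the link of a Euclidean point of an
  acyclic path connected space is a homology sphere (the tree's Mayer–Vietoris argument of
  `ContractiblePunctured.lean`, with contractibility weakened to acyclicity).
* `NullCobordism.isIso_map_inclToComplCenter` (the duality step, proved for the subclass),
  `NullCobordism.isIso_map_inl_ballRemoval`, `isIso_map_inr_ballRemoval`: both ends of the
  ball-removal cobordism induce isomorphisms on `Hₖ(-; ℤ)` for all `k`.
* `NullCobordism.isHCobordism_ballRemoval_of_whitehead`, `NullCobordism.isHCobordant_sphere_of_whitehead`.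

## References

* M. Kervaire, J. Milnor, *Groups of homotopy spheres I*, Ann. of Math. (2) 77 (1963), proof of
  Lemma 2.3 (p. 506). doi:10.2307/1970128 [KervaireMilnorAnnals1963]
* A. Hatcher, *Algebraic Topology*, CUP (2002), Thm. 2.16, Lemma 3.27, Prop. 3.25, Cor. 4.33.
  [HatcherAT2002]
* J. Milnor, *On spaces having the homotopy type of a CW-complex*, Trans. AMS 90 (1959), Cor. 1.
  [Milnor1959]
-/

open scoped Manifold ContDiff Topology ContinuousMap unitInterval
open Set Function Metric CategoryTheory CategoryTheory.Limits
open Literature.AlgebraicTopology.SingularHomology Literature.AlgebraicTopology.Homotopy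

noncomputable section

namespace Literature.Topology.FourManifolds

/-- Local notation: `𝔼 n` is the model Euclidean space `EuclideanSpace ℝ (Fin n)`. -/
local notation "𝔼 " n:arg => EuclideanSpace ℝ (Fin n)
/-- Local notation: `𝕊 n` is the unit sphere in `EuclideanSpace ℝ (Fin (n + 1))`. -/
local notation "𝕊 " n:arg => (Metric.sphere (0 : EuclideanSpace ℝ (Fin (n + 1))) 1)

/-! ### Algebra: surjections between copies of `ℤ` -/

section Algebra

/-- **A surjective homomorphism between two infinite cyclic `ℤ`-modules is an isomorphism**: made
into an endomorphism of one of them it is surjective, hence injective (a finitely generated module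
over a commutative ring is Hopfian, `OrzechProperty.injective_of_surjective_endomorphism`). [folklore] -/
theorem isIso_of_surjective_of_iso_int {A B : ModuleCat.{0} ℤ}
    (eA : A ≅ ModuleCat.of ℤ (ULift.{0} ℤ)) (eB : B ≅ ModuleCat.of ℤ (ULift.{0} ℤ)) (f : A ⟶ B)
    (hf : Function.Surjective f) : IsIso f := by
  haveI : Module.Finite ℤ (ULift.{0} ℤ) := Module.Finite.equiv ULift.moduleEquiv.symm
  haveI : Module.Finite ℤ A := Module.Finite.equiv eA.toLinearEquiv.symm
  -- the endomorphism `f ≫ eB.hom ≫ eA.inv` of `A` is surjective, hence injective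
  set g : A ⟶ A := f ≫ eB.hom ≫ eA.inv with hg
  have hgs : Function.Surjective g := by
    rw [hg]
    change Function.Surjective ((eB.hom ≫ eA.inv) ∘ f)
    exact ((eB ≪≫ eA.symm).toLinearEquiv.surjective).comp hf
  have hgi : Function.Injective g :=
    OrzechProperty.injective_of_surjective_endomorphism g.hom hgs
  have hfi : Function.Injective f := by
    refine Function.Injective.of_comp (f := (eB.hom ≫ eA.inv : B ⟶ A)) ?_
    change Function.Injective (f ≫ eB.hom ≫ eA.inv)
    exact hgi
  haveI : Mono f := (ModuleCat.mono_iff_injective f).2 hfi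
  haveI : Epi f := (ModuleCat.epi_iff_surjective f).2 hf
  exact isIso_of_mono_of_epi f

end Algebra

/-! ### The link of a Euclidean point of an acyclic space -/

section Link

variable (R : Type) [CommRing R] (A : Type) [AddCommGroup A] [Module R A]
variable {N : ℕ} {X : Type} [TopologicalSpace X] {i : 𝔼 (N + 1) → X}

/-- **Positive degrees, acyclic version** of the tree's
`isIso_singularHomology_map_inter_compl_center` (`ContractiblePunctured.lean`, there for `X`
contractible): for an open embedding `i : ℝᴺ⁺¹ → X` and `k ≥ 1` with `Hₖ₊₁(X) = Hₖ(X) = 0`, the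
inclusion `(X ∖ {i 0}) ∩ i(ℝᴺ⁺¹) ↪ X ∖ {i 0}` is an isomorphism on `Hₖ(-; A)` (Mayer–Vietoris for
`X = (X ∖ {i 0}) ∪ i(ℝᴺ⁺¹)`; Hatcher 2002, §2.2 p. 149). The tree's proof uses contractibility only
through these two vanishings. [cite: HatcherAT2002, §2.2 p. 149] -/
theorem isIso_singularHomology_map_inter_compl_center_of_isZero [T1Space X]
    (hi : Topology.IsOpenEmbedding i) {k : ℕ} (hk : k ≠ 0)
    (h₁ : IsZero (singularHomology R A X (k + 1))) (h₀ : IsZero (singularHomology R A X k)) :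
    IsIso (singularHomology.map R A
      (subsetInclusion (inter_subset_left : ({i 0}ᶜ : Set X) ∩ range i ⊆ {i 0}ᶜ)) k) :=
  mayerVietoris.isIso_map_inter_left_of_isZero R A _ _ (interior_compl_union_interior_range hi) k
    h₁ h₀ (isZero_singularHomology_range R A hi hk)

/-- **The link of a Euclidean point of an acyclic path connected space is a homology sphere**
(acyclic version of the tree's `isIso_singularHomology_map_sphereToComplCenter`, whose proof uses
`ContractibleSpace X` only through `Hₖ(X) = 0`, `k ≥ 1`, and path connectedness): for `X : Type`
Hausdorff, path connected, with `Hₖ(X; A) = 0` for all `k ≥ 1`, and `i : ℝᴺ⁺¹ → X` an open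
embedding, `N ≥ 1`, the map `y ↦ i y : 𝕊ᴺ → X ∖ {i 0}` induces isomorphisms on all `Hₖ(-; A)`.
Kervaire–Milnor 1963, proof of Lemma 2.3: "the inclusion `Sⁿ → W` induces a homology isomorphism".
[cite: KervaireMilnorAnnals1963, Lemma 2.3, proof (p. 506)] -/
theorem isIso_singularHomology_map_sphereToComplCenter_of_isZero [T2Space X] [PathConnectedSpace X]
    (hi : Topology.IsOpenEmbedding i) (hN : 1 ≤ N)
    (hac : ∀ k, 1 ≤ k → IsZero (singularHomology R A X k)) (k : ℕ) :
    IsIso (singularHomology.map R A (sphereToComplCenter hi.isEmbedding) k) := by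
  rcases Nat.eq_zero_or_pos k with rfl | hk
  · haveI := pathConnectedSpace_compl_center hi hN
    haveI := pathConnectedSpace_sphere (n := N) (by omega)
    exact singularHomology.isIso_map_zero_of_pathConnectedSpace R A _
  · haveI := isIso_singularHomology_map_inter_compl_center_of_isZero R A hi hk.ne'
      (hac _ (by omega)) (hac _ hk)
    haveI := isIso_singularHomology_map_sphereToComplZero R A N k
    rw [sphereToComplCenter_eq, singularHomology.map_comp, singularHomology.map_comp,
      ← singularHomology.mapIso_hom]
    infer_instance

end Link

/-! ### The null-cobordism: collar, interior, core -/

namespace NullCobordism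

variable {m : ℕ} {M : Type} [TopologicalSpace M] [T2Space M] [SecondCountableTopology M]
  [ChartedSpace (𝔼 (m + 1)) M] [IsManifold (𝓡 (m + 1)) ∞ M] [CompactSpace M] [Nonempty M]
  (c₀ : NullCobordism (m + 1) M)

omit [T2Space M] [SecondCountableTopology M] [Nonempty M] in
/-- **A topological collar of `∂W' = M`**: a closed embedding `κ : M × [0, 1] → W'` with
`κ (M × [0, 1))` open and `κ (x, 0) = incl x` (from the smooth collar theorem for compact manifolds
with boundary, `BoundaryData.nonempty_collar_of_compactSpace`; Hirsch 1976, Thm. 4.6.1; Milnor 1965,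
§1). [folklore] -/
theorem exists_boundaryCollar :
    ∃ κ : BoundaryCollar c₀.W M, ∀ x : M, κ.collar (x, 0) = c₀.incl x := by
  obtain ⟨col⟩ := BoundaryData.nonempty_collar_of_compactSpace m c₀.W c₀.boundaryData
  haveI : CompactSpace (c₀.boundaryData.carrier × (Icc (0 : ℝ) 1)) :=
    inferInstanceAs (CompactSpace (M × I))
  exact ⟨⟨col.toFun, col.continuous.isClosedEmbedding col.injective, col.isOpen_image⟩,
    fun x => col.apply_bot x⟩

omit [T2Space M] [SecondCountableTopology M] [IsManifold (𝓡 (m + 1)) ∞ M] [CompactSpace M]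
  [Nonempty M] in
/-- The interior of a collar of `∂W' = M` is the manifold interior of `W'`. [folklore] -/
theorem boundaryCollar_interior_eq {κ : BoundaryCollar c₀.W M} (hκ : ∀ x : M, κ.collar (x, 0) = c₀.incl x) :
    κ.interior = (𝓡∂ (m + 1 + 1)).interior c₀.W := by
  rw [BoundaryCollar.interior, ← ModelWithCorners.compl_boundary, ← c₀.range_incl]
  congr 1
  exact congrArg range (funext hκ)

/-- The interior `X` of `W'` as a boundaryless topological `(m+2)`-manifold (`InteriorManifold`).
[folklore] -/
abbrev Interior : Type := InteriorManifold (𝓡∂ (m + 1 + 1)) c₀.W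

/-- The homeomorphism of the interior manifold `X` onto the interior of a collar (the inclusion
`val`). [folklore] -/
def interiorHomeomorph {κ : BoundaryCollar c₀.W M} (hκ : ∀ x : M, κ.collar (x, 0) = c₀.incl x) :
    c₀.Interior ≃ₜ ↥κ.interior :=
  (InteriorManifold.isEmbedding_val : Topology.IsEmbedding (InteriorManifold.val : c₀.Interior → c₀.W)).toHomeomorph.trans
    (Homeomorph.setCongr (by rw [InteriorManifold.range_val, c₀.boundaryCollar_interior_eq hκ]))

omit [T2Space M] [SecondCountableTopology M] [IsManifold (𝓡 (m + 1)) ∞ M] [CompactSpace M]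
  [Nonempty M] in
/-- The homeomorphism is `val` on points. [folklore] -/
@[simp] theorem coe_interiorHomeomorph {κ : BoundaryCollar c₀.W M} (hκ : ∀ x : M, κ.collar (x, 0) = c₀.incl x)
    (x : c₀.Interior) : (c₀.interiorHomeomorph hκ x : c₀.W) = x.val := by
  change ((InteriorManifold.isEmbedding_val : Topology.IsEmbedding (InteriorManifold.val : c₀.Interior → c₀.W)).toHomeomorph x :
    c₀.W) = x.val
  exact Topology.IsEmbedding.toHomeomorph_apply_coe _ x

/-- **The interior is homotopy equivalent to `W'`** (through a collar), by the map `val`. [folklore] -/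
def interiorValHomotopyEquiv {κ : BoundaryCollar c₀.W M} (hκ : ∀ x : M, κ.collar (x, 0) = c₀.incl x) :
    c₀.Interior ≃ₕ c₀.W :=
  (c₀.interiorHomeomorph hκ).toHomotopyEquiv.trans (κ.interiorHomotopyEquiv (t := 1) zero_lt_one)

omit [T2Space M] [SecondCountableTopology M] in
/-- The interior of a simply connected `W'` is simply connected. [folklore] -/
theorem simplyConnectedSpace_interior [SimplyConnectedSpace c₀.W] : SimplyConnectedSpace c₀.Interior := by
  obtain ⟨κ, hκ⟩ := c₀.exists_boundaryCollar
  exact (c₀.interiorValHomotopyEquiv hκ).simplyConnectedSpace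

omit [T2Space M] [SecondCountableTopology M] in
/-- The interior has the homology of `W'`: `Hₖ(X; ℤ) = 0` when `Hₖ(W'; ℤ) = 0`. [folklore] -/
theorem isZero_singularHomology_interior {k : ℕ} (h : IsZero (singularHomology ℤ ℤ c₀.W k)) :
    IsZero (singularHomology ℤ ℤ c₀.Interior k) := by
  obtain ⟨κ, hκ⟩ := c₀.exists_boundaryCollar
  exact h.of_iso (singularHomology.isoOfHomotopyEquiv ℤ ℤ (c₀.interiorValHomotopyEquiv hκ) k)

variable (D : BallRemovalData (m + 1) c₀.W)

/-- The disc `i : ℝᵐ⁺² → W'` of ball-removal data, as an open embedding into the interior `X`.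
[folklore] -/
def discInterior (v : 𝔼 (m + 1 + 1)) : c₀.Interior := ⟨D.i v, D.isInteriorPoint_i v⟩

omit [T2Space M] [SecondCountableTopology M] [IsManifold (𝓡 (m + 1)) ∞ M] [CompactSpace M]
  [Nonempty M] in
/-- `val ∘ discInterior = i`. [folklore] -/
@[simp] theorem discInterior_val (v : 𝔼 (m + 1 + 1)) : (c₀.discInterior D v).val = D.i v := rfl

omit [T2Space M] [SecondCountableTopology M] [IsManifold (𝓡 (m + 1)) ∞ M] [CompactSpace M]
  [Nonempty M] in
/-- The disc is an open embedding into the interior. [folklore] -/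
theorem isOpenEmbedding_discInterior : Topology.IsOpenEmbedding (c₀.discInterior D) :=
  (Topology.IsOpenEmbedding.of_comp_iff (c₀.discInterior D)
    (InteriorManifold.isOpenEmbedding_val :
      Topology.IsOpenEmbedding (InteriorManifold.val : c₀.Interior → c₀.W))).1 D.isOpenEmbedding_i

/-- The centre `c = i 0` of the ball, as a point of the interior. [folklore] -/
abbrev ctr : c₀.Interior := c₀.discInterior D 0

omit [T2Space M] [SecondCountableTopology M] [IsManifold (𝓡 (m + 1)) ∞ M] [CompactSpace M]
  [Nonempty M] in
/-- **A level `t > 0` of the collar below the centre of the ball**: `c ∉ κ (M × [0, t])`. If `c` is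
off the collar any positive level works; if `c = κ (a, s)` (then `s > 0`, `c` being interior) take
`t = s/2`. [folklore] -/
theorem exists_level {κ : BoundaryCollar c₀.W M} (hκ : ∀ x : M, κ.collar (x, 0) = c₀.incl x) :
    ∃ t : I, 0 < t ∧ D.i 0 ∉ κ.collar '' {q | q.2 ≤ t} := by
  by_cases hr : D.i 0 ∈ range κ.collar
  · obtain ⟨⟨a, s⟩, hq⟩ := hr
    have hs : 0 < s := by
      have hint : κ.collar (a, s) ∈ κ.interior := by
        rw [c₀.boundaryCollar_interior_eq hκ, hq]
        exact D.isInteriorPoint_i 0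
      exact κ.collar_mem_interior_iff.1 hint
    have hs' : (0 : ℝ) < s := hs
    refine ⟨⟨(s : ℝ) / 2, by constructor <;> linarith [s.2.2]⟩, ?_, ?_⟩
    · show (0 : ℝ) < s / 2
      linarith
    · rintro ⟨q, hq', h⟩
      rw [← hq] at h
      have := κ.injective h
      subst this
      have : (s : ℝ) ≤ s / 2 := hq'
      linarith
  · exact ⟨1, zero_lt_one, fun ⟨q, _, h⟩ => hr ⟨q, h⟩⟩

/-- The compact core `K = val⁻¹ (W' ∖ κ (M × [0, t)))` of the interior. [folklore] -/
def coreInterior (κ : BoundaryCollar c₀.W M) (t : I) : Set c₀.Interior := InteriorManifold.val ⁻¹' κ.core t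

omit [T2Space M] [SecondCountableTopology M] [IsManifold (𝓡 (m + 1)) ∞ M] [CompactSpace M]
  [Nonempty M] in
/-- The core of the interior is compact (it is a copy of the compact core of `W'`). [folklore] -/
theorem isCompact_coreInterior {κ : BoundaryCollar c₀.W M} (hκ : ∀ x : M, κ.collar (x, 0) = c₀.incl x)
    {t : I} (ht : 0 < t) : IsCompact (c₀.coreInterior κ t) := by
  rw [(InteriorManifold.isEmbedding_val : Topology.IsEmbedding (InteriorManifold.val : c₀.Interior → c₀.W)).isCompact_iff,
    coreInterior, image_preimage_eq_of_subset]
  · exact κ.isCompact_core t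
  · rw [InteriorManifold.range_val, ← c₀.boundaryCollar_interior_eq hκ]
    exact κ.core_subset_interior ht

omit [T2Space M] [SecondCountableTopology M] [IsManifold (𝓡 (m + 1)) ∞ M] [CompactSpace M]
  [Nonempty M] in
/-- The centre lies in the core when it is above the level. [folklore] -/
theorem ctr_mem_coreInterior {κ : BoundaryCollar c₀.W M} {t : I} (hc : D.i 0 ∉ κ.collar '' {q | q.2 ≤ t}) :
    c₀.ctr D ∈ c₀.coreInterior κ t :=
  κ.mem_core_of_not_mem_image hc

/-- A point of the interior of the collar, as a point of the interior manifold `X`. [folklore] -/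
def ofInterior {κ : BoundaryCollar c₀.W M} (hκ : ∀ x : M, κ.collar (x, 0) = c₀.incl x) (w : c₀.W)
    (hw : w ∈ κ.interior) : c₀.Interior :=
  ⟨w, by rw [c₀.boundaryCollar_interior_eq hκ] at hw; exact hw⟩

omit [T2Space M] [SecondCountableTopology M] [IsManifold (𝓡 (m + 1)) ∞ M] [CompactSpace M]
  [Nonempty M] in
/-- `ofInterior` on points (definitional). [folklore] -/
@[simp] theorem ofInterior_val {κ : BoundaryCollar c₀.W M} (hκ : ∀ x : M, κ.collar (x, 0) = c₀.incl x)
    (w : c₀.W) (hw : w ∈ κ.interior) : (c₀.ofInterior hκ w hw).val = w := rfl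

/-- **The slice `x ↦ κ (x, u)`, `0 < u < t`, as a map `M → X ∖ K`**, the complement of the core in
the interior (it is a homotopy equivalence, `isIso_map_sliceInterior`). [folklore] -/
def sliceInterior {κ : BoundaryCollar c₀.W M} (hκ : ∀ x : M, κ.collar (x, 0) = c₀.incl x) {u t : I}
    (hu : 0 < u) (hut : u < t) : C(M, ↥((c₀.coreInterior κ t)ᶜ)) where
  toFun x := ⟨c₀.ofInterior hκ (κ.collar (x, u)) (κ.collar_mem_interior_iff.2 hu),
    fun h => (not_le.2 hut) (κ.collar_mem_core_iff.1 h)⟩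
  continuous_toFun := by
    refine Continuous.subtype_mk ?_ _
    rw [InteriorManifold.continuous_iff_comp_val]
    exact κ.continuous.comp (Continuous.prodMk_left u)

omit [T2Space M] [SecondCountableTopology M] [IsManifold (𝓡 (m + 1)) ∞ M] [CompactSpace M]
  [Nonempty M] in
/-- The slice on points (definitional). [folklore] -/
@[simp] theorem sliceInterior_val {κ : BoundaryCollar c₀.W M} (hκ : ∀ x : M, κ.collar (x, 0) = c₀.incl x)
    {u t : I} (hu : 0 < u) (hut : u < t) (x : M) :
    ((c₀.sliceInterior hκ hu hut x : ↥((c₀.coreInterior κ t)ᶜ)) : c₀.Interior).val = κ.collar (x, u) := rfl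

omit [T2Space M] [SecondCountableTopology M] [IsManifold (𝓡 (m + 1)) ∞ M] [CompactSpace M]
  [Nonempty M] in
/-- Points of the complement of the core of the interior lie on the strip `κ (M × (0, t))`. [folklore] -/
theorem val_mem_strip_of_mem_compl_coreInterior {κ : BoundaryCollar c₀.W M}
    (hκ : ∀ x : M, κ.collar (x, 0) = c₀.incl x) {t : I} (x : ↥((c₀.coreInterior κ t)ᶜ)) :
    (x : c₀.Interior).val ∈ κ.strip t := by
  rw [← κ.interior_diff_core]
  refine ⟨?_, x.2⟩
  rw [c₀.boundaryCollar_interior_eq hκ]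
  exact (x : c₀.Interior).property

/-- The map of the strip `κ (M × (0, t))` onto the complement of the core in the interior. [folklore] -/
def stripToInterior {κ : BoundaryCollar c₀.W M} (hκ : ∀ x : M, κ.collar (x, 0) = c₀.incl x) (t : I) :
    C(↥(κ.strip t), ↥((c₀.coreInterior κ t)ᶜ)) where
  toFun w := ⟨c₀.ofInterior hκ (w : c₀.W) ((κ.strip_eq t).le w.2).1, fun h => h ((κ.strip_eq t).le w.2).2⟩
  continuous_toFun := by
    refine Continuous.subtype_mk ?_ _
    rw [InteriorManifold.continuous_iff_comp_val]
    exact continuous_subtype_val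

/-- The map of the strip onto the complement of the core is a homeomorphism. [folklore] -/
def stripHomeomorphInterior {κ : BoundaryCollar c₀.W M} (hκ : ∀ x : M, κ.collar (x, 0) = c₀.incl x) (t : I) :
    ↥(κ.strip t) ≃ₜ ↥((c₀.coreInterior κ t)ᶜ) where
  toFun := c₀.stripToInterior hκ t
  invFun x := ⟨(x : c₀.Interior).val, c₀.val_mem_strip_of_mem_compl_coreInterior hκ x⟩
  left_inv _ := rfl
  right_inv _ := rfl
  continuous_toFun := (c₀.stripToInterior hκ t).continuous
  continuous_invFun := (InteriorManifold.continuous_val.comp continuous_subtype_val).subtype_mk _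

omit [T2Space M] [SecondCountableTopology M] [IsManifold (𝓡 (m + 1)) ∞ M] [CompactSpace M]
  [Nonempty M] in
/-- The strip map induces isomorphisms on homology (it is a homeomorphism). [folklore] -/
theorem isIso_map_stripToInterior {κ : BoundaryCollar c₀.W M} (hκ : ∀ x : M, κ.collar (x, 0) = c₀.incl x)
    (t : I) (k : ℕ) : IsIso (singularHomology.map ℤ ℤ (c₀.stripToInterior hκ t) k) := by
  have hΦ : ((c₀.stripHomeomorphInterior hκ t : ↥(κ.strip t) ≃ₜ ↥((c₀.coreInterior κ t)ᶜ)) : C(_, _)) =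
      c₀.stripToInterior hκ t := by
    ext x : 1
    rfl
  have h := (inferInstance : IsIso (singularHomology.mapIso ℤ ℤ (c₀.stripHomeomorphInterior hκ t) k).hom)
  rw [singularHomology.mapIso_hom, hΦ] at h
  exact h

omit [T2Space M] [SecondCountableTopology M] [IsManifold (𝓡 (m + 1)) ∞ M] [CompactSpace M] in
/-- **The slice `M → X ∖ K` induces isomorphisms on homology**: it is the homotopy equivalence
`M ≃ₕ κ (M × (0, t))` (`BoundaryCollar.stripHomotopyEquiv`) followed by the homeomorphism of the
strip onto `X ∖ K`. [folklore] -/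
theorem isIso_map_sliceInterior {κ : BoundaryCollar c₀.W M} (hκ : ∀ x : M, κ.collar (x, 0) = c₀.incl x)
    {u t : I} (hu : 0 < u) (hut : u < t) (k : ℕ) :
    IsIso (singularHomology.map ℤ ℤ (c₀.sliceInterior hκ hu hut) k) := by
  have hfac : (c₀.sliceInterior hκ hu hut : C(M, ↥((c₀.coreInterior κ t)ᶜ))) =
      (c₀.stripToInterior hκ t).comp (κ.stripHomotopyEquiv hu hut).toFun := by
    ext x : 1
    rfl
  rw [hfac, singularHomology.map_comp]
  haveI : IsIso (singularHomology.map ℤ ℤ (κ.stripHomotopyEquiv hu hut).toFun k) :=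
    (inferInstance : IsIso (singularHomology.isoOfHomotopyEquiv ℤ ℤ (κ.stripHomotopyEquiv hu hut) k).hom)
  haveI := c₀.isIso_map_stripToInterior hκ t k
  infer_instance

/-! ### The punctured interior: homology -/

omit [T2Space M] [SecondCountableTopology M] in
/-- The punctured interior `X ∖ {c}` is path connected (`dim X ≥ 2`). [folklore] -/
theorem pathConnectedSpace_compl_ctr [SimplyConnectedSpace c₀.W] :
    PathConnectedSpace ↥(({c₀.ctr D}ᶜ : Set c₀.Interior)) := by
  haveI := c₀.simplyConnectedSpace_interior
  rw [← isPathConnected_iff_pathConnectedSpace]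
  exact Literature.AlgebraicTopology.FundamentalGroupoid.isPathConnected_compl_singleton_of_isOpenEmbedding
    (c₀.isOpenEmbedding_discInterior D) (by rw [finrank_euclideanSpace_fin]; omega)

/-- The inclusion `X ∖ K ↪ X ∖ {c}` of the complement of the core into the punctured interior, as a
map of subtypes (the map of `HomologicalOrientation.map_compl_surjective`). [folklore] -/
abbrev coreComplIncl (κ : BoundaryCollar c₀.W M) (t : I) (hc : c₀.ctr D ∈ c₀.coreInterior κ t) :
    C(↥((c₀.coreInterior κ t)ᶜ), ↥(({c₀.ctr D}ᶜ : Set c₀.Interior))) :=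
  subsetRestrict (ContinuousMap.id c₀.Interior)
    (fun _ hx => Set.compl_subset_compl.2 (Set.singleton_subset_iff.2 hc) hx)

omit [T2Space M] [SecondCountableTopology M] in
/-- **`Hₘ₊₁(X ∖ K) → Hₘ₊₁(X ∖ {c})` is surjective** (`HomologicalOrientation.map_compl_surjective`
for the `ℤ`-orientation of the simply connected interior `X`, Hatcher Prop. 3.25, and the compact
core `K`). [cite: HatcherAT2002, Lemma 3.27 and Prop. 3.25] -/
theorem surjective_map_coreComplIncl [SimplyConnectedSpace c₀.W]
    (hac : ∀ k, 1 ≤ k → IsZero (singularHomology ℤ ℤ c₀.W k)) {κ : BoundaryCollar c₀.W M}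
    (hκ : ∀ x : M, κ.collar (x, 0) = c₀.incl x) {t : I} (ht : 0 < t) (hc : c₀.ctr D ∈ c₀.coreInterior κ t) :
    Function.Surjective (singularHomology.map ℤ ℤ (c₀.coreComplIncl D κ t hc) (m + 1)) := by
  haveI := c₀.simplyConnectedSpace_interior
  obtain ⟨μ⟩ := isOrientableOver_of_simplyConnectedSpace ℤ c₀.Interior (n := m + 1 + 1)
  exact μ.map_compl_surjective (c₀.ctr D) (c₀.isZero_singularHomology_interior (hac _ (by omega)))
    (c₀.isZero_singularHomology_interior (hac _ (by omega))) (c₀.isCompact_coreInterior hκ ht) hc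

omit [T2Space M] [SecondCountableTopology M] in
/-- **The slice `M → X ∖ {c}`, `x ↦ κ (x, u)`, induces isomorphisms on all `Hₖ`** when `W'` is simply
connected and acyclic, and `M` is path connected with the integral homology of `𝕊ᵐ⁺¹`: in degree
`m + 1` the map `Hₘ₊₁(M) ≅ Hₘ₊₁(X ∖ K) → Hₘ₊₁(X ∖ c)` is onto (`surjective_map_coreComplIncl`)
between two copies of `ℤ`, hence an isomorphism; the other positive degrees vanish on both sides;
degree `0` by path-connectedness. This is "the inclusion `M → W` also induces isomorphisms of
homology groups" in Kervaire–Milnor's proof of Lemma 2.3 (1963, p. 506), obtained there from Poincaré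
duality. [cite: KervaireMilnorAnnals1963, Lemma 2.3, proof (p. 506)] -/
theorem isIso_map_sliceCompl [SimplyConnectedSpace c₀.W] [PathConnectedSpace M]
    (hac : ∀ k, 1 ≤ k → IsZero (singularHomology ℤ ℤ c₀.W k))
    (hMtop : Nonempty (singularHomology ℤ ℤ M (m + 1) ≅ ModuleCat.of ℤ (ULift.{0} ℤ)))
    (hMmid : ∀ k, 1 ≤ k → k ≠ m + 1 → IsZero (singularHomology ℤ ℤ M k))
    {κ : BoundaryCollar c₀.W M} (hκ : ∀ x : M, κ.collar (x, 0) = c₀.incl x) {u t : I} (hu : 0 < u)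
    (hut : u < t) (hc : c₀.ctr D ∈ c₀.coreInterior κ t) (k : ℕ) :
    IsIso (singularHomology.map ℤ ℤ ((c₀.coreComplIncl D κ t hc).comp (c₀.sliceInterior hκ hu hut)) k) := by
  have ht : 0 < t := lt_trans hu hut
  rcases Nat.eq_zero_or_pos k with rfl | hk
  · haveI := c₀.pathConnectedSpace_compl_ctr D
    exact singularHomology.isIso_map_zero_of_pathConnectedSpace ℤ ℤ _
  · by_cases hkm : k = m + 1
    · subst hkm
      obtain ⟨eM⟩ := hMtop
      obtain ⟨eC⟩ := HomologicalOrientation.nonempty_iso_singularHomology_compl_singleton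
        (R := ℤ) (n := m + 1) (c₀.ctr D) (c₀.isZero_singularHomology_interior (hac _ (by omega)))
        (c₀.isZero_singularHomology_interior (hac _ (by omega)))
      refine isIso_of_surjective_of_iso_int eM eC _ ?_
      rw [singularHomology.map_comp]
      change Function.Surjective ((singularHomology.map ℤ ℤ (c₀.coreComplIncl D κ t hc) (m + 1)) ∘
        (singularHomology.map ℤ ℤ (c₀.sliceInterior hκ hu hut) (m + 1)))
      haveI := c₀.isIso_map_sliceInterior hκ hu hut (m + 1)
      exact (c₀.surjective_map_coreComplIncl D hac hκ ht hc).comp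
        (asIso (singularHomology.map ℤ ℤ (c₀.sliceInterior hκ hu hut) (m + 1))).toLinearEquiv.surjective
    · exact (hMmid k hk hkm).isIso
        (isZero_singularHomology_compl_singleton_of_isZero (n := m + 1) (c₀.ctr D) hkm
          (c₀.isZero_singularHomology_interior (hac k hk))) _

/-! ### From the punctured interior to the complement of the ball in `W'` -/

/-- The inclusion `X ∖ {c} → W' ∖ {i 0}` (the map `val`). [folklore] -/
def valCompl : C(↥(({c₀.ctr D}ᶜ : Set c₀.Interior)), ↥(({D.i 0}ᶜ : Set c₀.W))) :=
  ⟨fun x => ⟨(x : c₀.Interior).val, fun h => x.2 (InteriorManifold.val_injective h)⟩,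
    (InteriorManifold.continuous_val.comp continuous_subtype_val).subtype_mk _⟩

omit [T2Space M] [SecondCountableTopology M] [IsManifold (𝓡 (m + 1)) ∞ M] [CompactSpace M]
  [Nonempty M] in
/-- `valCompl` on points (definitional). [folklore] -/
@[simp] theorem coe_valCompl (x : ↥(({c₀.ctr D}ᶜ : Set c₀.Interior))) :
    (c₀.valCompl D x : c₀.W) = (x : c₀.Interior).val := rfl

/-- The homeomorphism of the punctured interior `X ∖ {c}` onto `κ.interior ∖ {i 0}` (the map
`val`). [folklore] -/
def ctrComplHomeomorph {κ : BoundaryCollar c₀.W M} (hκ : ∀ x : M, κ.collar (x, 0) = c₀.incl x) :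
    ↥(({c₀.ctr D}ᶜ : Set c₀.Interior)) ≃ₜ ↥(κ.interior ∩ {D.i 0}ᶜ) where
  toFun x := ⟨(x : c₀.Interior).val,
    ⟨by rw [c₀.boundaryCollar_interior_eq hκ]; exact (x : c₀.Interior).property,
      fun h => x.2 (InteriorManifold.val_injective h)⟩⟩
  invFun w := ⟨c₀.ofInterior hκ (w : c₀.W) w.2.1, fun h => w.2.2 (congrArg InteriorManifold.val h)⟩
  left_inv _ := rfl
  right_inv _ := rfl
  continuous_toFun := (InteriorManifold.continuous_val.comp continuous_subtype_val).subtype_mk _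
  continuous_invFun := by
    refine Continuous.subtype_mk ?_ _
    rw [InteriorManifold.continuous_iff_comp_val]
    exact continuous_subtype_val

/-- **`X ∖ {c} ≃ₕ W' ∖ {i 0}`** by the map `val`: the homeomorphism onto `κ.interior ∖ {i 0}` followed
by the homotopy equivalence `BoundaryCollar.interiorComplHomotopyEquiv` (the push off the collar,
the centre being above the level `t`). [folklore] -/
def valComplHomotopyEquiv {κ : BoundaryCollar c₀.W M} (hκ : ∀ x : M, κ.collar (x, 0) = c₀.incl x)
    {t : I} (ht : 0 < t) (hc : D.i 0 ∉ κ.collar '' {q | q.2 ≤ t}) :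
    ↥(({c₀.ctr D}ᶜ : Set c₀.Interior)) ≃ₕ ↥(({D.i 0}ᶜ : Set c₀.W)) :=
  (c₀.ctrComplHomeomorph D hκ).toHomotopyEquiv.trans (κ.interiorComplHomotopyEquiv ht hc)

omit [T2Space M] [SecondCountableTopology M] [IsManifold (𝓡 (m + 1)) ∞ M] [CompactSpace M] in
/-- The forward map of `valComplHomotopyEquiv` is `valCompl`. [folklore] -/
theorem valComplHomotopyEquiv_toFun {κ : BoundaryCollar c₀.W M} (hκ : ∀ x : M, κ.collar (x, 0) = c₀.incl x)
    {t : I} (ht : 0 < t) (hc : D.i 0 ∉ κ.collar '' {q | q.2 ≤ t}) :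
    (c₀.valComplHomotopyEquiv D hκ ht hc).toFun = c₀.valCompl D := by
  ext x : 1
  rfl

omit [T2Space M] [SecondCountableTopology M] [IsManifold (𝓡 (m + 1)) ∞ M] [CompactSpace M] in
/-- **`X ∖ {c} → W' ∖ {i 0}` induces isomorphisms on homology** (it is a homotopy equivalence,
`valComplHomotopyEquiv`). [folklore] -/
theorem isIso_map_valCompl {κ : BoundaryCollar c₀.W M} (hκ : ∀ x : M, κ.collar (x, 0) = c₀.incl x)
    {t : I} (ht : 0 < t) (hc : D.i 0 ∉ κ.collar '' {q | q.2 ≤ t}) (k : ℕ) :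
    IsIso (singularHomology.map ℤ ℤ (c₀.valCompl D) k) := by
  rw [← c₀.valComplHomotopyEquiv_toFun D hκ ht hc]
  exact (inferInstance : IsIso (singularHomology.isoOfHomotopyEquiv ℤ ℤ
    (c₀.valComplHomotopyEquiv D hκ ht hc) k).hom)

/-! ### The ends of the ball-removal cobordism -/

/-- The total space `K ≅ W' ∖ i(B̊)` of the ball-removal cobordism is homotopy equivalent to the
punctured interior `X ∖ {c}`: `K ≃ₕ W' ∖ {i 0}` (tree: `BallRemovalData.homotopyEquivComplCenter`,
`HomotopySpheresInverseHomotopy.lean`) and `X ∖ {c} ≃ₕ W' ∖ {i 0}` (`valComplHomotopyEquiv`). [folklore] -/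
def kHomotopyEquiv {κ : BoundaryCollar c₀.W M} (hκ : ∀ x : M, κ.collar (x, 0) = c₀.incl x)
    {t : I} (ht : 0 < t) (hc : D.i 0 ∉ κ.collar '' {q | q.2 ≤ t}) :
    D.K ≃ₕ ↥(({c₀.ctr D}ᶜ : Set c₀.Interior)) :=
  (D.homotopyEquivComplCenter c₀).trans (c₀.valComplHomotopyEquiv D hκ ht hc).symm

omit [T2Space M] [SecondCountableTopology M] [IsManifold (𝓡 (m + 1)) ∞ M] [CompactSpace M]
  [Nonempty M] in
/-- `K` is simply connected when `W'` is (`m ≥ 1`): `K ≃ W' ∖ {i 0}`, and removing a point from a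
simply connected manifold of dimension `≥ 3` keeps it simply connected (general position). This is
the tree's `BallRemovalData.simplyConnectedSpace_K` (`HomotopySpheresInverseHomotopy.lean`) with its
hypothesis `ContractibleSpace W'` weakened to `SimplyConnectedSpace W'`, which is all its proof uses.
[folklore] -/
theorem simplyConnectedSpace_k [SimplyConnectedSpace c₀.W] (hm : 1 ≤ m) : SimplyConnectedSpace D.K := by
  haveI : SimplyConnectedSpace ↥(({D.i 0}ᶜ : Set c₀.W)) :=
    Literature.AlgebraicTopology.FundamentalGroupoid.isSimplyConnected_compl_singleton_of_isOpenEmbedding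
      D.isOpenEmbedding_i (by rw [finrank_euclideanSpace_fin]; omega)
  exact (D.homotopyEquivComplCenter c₀).simplyConnectedSpace

omit [T2Space M] [SecondCountableTopology M] [IsManifold (𝓡 (m + 1)) ∞ M] [CompactSpace M]
  [Nonempty M] in
/-- The boundary mapped into `W' ∖ {i 0}` (`BallRemovalData.inclToComplCenter`) is the bottom slice
`x ↦ κ (x, 0)` of a collar. [folklore] -/
theorem inclToComplCenter_eq {κ : BoundaryCollar c₀.W M} (hκ : ∀ x : M, κ.collar (x, 0) = c₀.incl x)
    {t : I} (hc : D.i 0 ∉ κ.collar '' {q | q.2 ≤ t}) :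
    D.inclToComplCenter c₀ =
      (⟨fun a => ⟨κ.collar (a, 0), fun h => hc ⟨(a, 0), (t.2.1 : (0 : I) ≤ t), h⟩⟩,
        (κ.continuous.comp (Continuous.prodMk_left 0)).subtype_mk _⟩ : C(M, ↥(({D.i 0}ᶜ : Set c₀.W)))) := by
  ext x : 1
  apply Subtype.ext
  show c₀.incl x = κ.collar (x, 0)
  rw [hκ]

omit [T2Space M] [SecondCountableTopology M] [IsManifold (𝓡 (m + 1)) ∞ M] [CompactSpace M]
  [Nonempty M] in
/-- The slice at level `u`, composed into `W' ∖ {i 0}`. [folklore] -/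
theorem slice_comp_eq {κ : BoundaryCollar c₀.W M} (hκ : ∀ x : M, κ.collar (x, 0) = c₀.incl x)
    {u t : I} (hu : 0 < u) (hut : u < t) (hc : D.i 0 ∉ κ.collar '' {q | q.2 ≤ t}) :
    (c₀.valCompl D).comp ((c₀.coreComplIncl D κ t (c₀.ctr_mem_coreInterior D hc)).comp (c₀.sliceInterior hκ hu hut)) =
      (⟨fun a => ⟨κ.collar (a, u), fun h => hc ⟨(a, u), le_of_lt hut, h⟩⟩,
        (κ.continuous.comp (Continuous.prodMk_left u)).subtype_mk _⟩ : C(M, ↥(({D.i 0}ᶜ : Set c₀.W)))) := by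
  ext x : 1
  rfl

omit [T2Space M] [SecondCountableTopology M] [IsManifold (𝓡 (m + 1)) ∞ M] [CompactSpace M]
  [Nonempty M] in
/-- **The embedded sphere `𝕊ᵐ⁺¹ → W' ∖ {i 0}` induces isomorphisms on all `Hₖ(-; ℤ)`** for `W'`
simply connected (hence path connected) with `Hₖ(W'; ℤ) = 0`, `k ≥ 1`
(`isIso_singularHomology_map_sphereToComplCenter_of_isZero` applied in `W'`, the disc having
dimension `m + 2 ≥ 2`). [cite: KervaireMilnorAnnals1963, Lemma 2.3, proof (p. 506)] -/
theorem isIso_map_sphereToComplCenter [SimplyConnectedSpace c₀.W]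
    (hac : ∀ k, 1 ≤ k → IsZero (singularHomology ℤ ℤ c₀.W k)) (k : ℕ) :
    IsIso (singularHomology.map ℤ ℤ (sphereToComplCenter D.isOpenEmbedding_i.isEmbedding) k) :=
  isIso_singularHomology_map_sphereToComplCenter_of_isZero ℤ ℤ D.isOpenEmbedding_i (Nat.succ_pos m) hac k

omit [T2Space M] [SecondCountableTopology M] [IsManifold (𝓡 (m + 1)) ∞ M] [CompactSpace M]
  [Nonempty M] in
/-- **The outgoing end `𝕊ᵐ⁺¹ → K` of the ball-removal cobordism induces isomorphisms on all
`Hₖ(-; ℤ)`** (for `W'` simply connected with `Hₖ(W'; ℤ) = 0`, `k ≥ 1`); compare the tree's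
`BallRemovalData.isIso_singularHomology_map_cobInrCM`, which assumes `W'` contractible.
[cite: KervaireMilnorAnnals1963, Lemma 2.3, proof (p. 506)] -/
theorem isIso_map_inr_ballRemoval [SimplyConnectedSpace c₀.W]
    (hac : ∀ k, 1 ≤ k → IsZero (singularHomology ℤ ℤ c₀.W k)) (k : ℕ) :
    IsIso (singularHomology.map ℤ ℤ (D.cobInrCM c₀) k) := by
  haveI := D.isIso_singularHomology_map_toComplCenter c₀ k
  haveI : IsIso (singularHomology.map ℤ ℤ (D.cobInrCM c₀) k ≫
      singularHomology.map ℤ ℤ (D.toComplCenter c₀) k) := by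
    rw [← singularHomology.map_comp, D.toComplCenter_comp_cobInrCM c₀]
    exact c₀.isIso_map_sphereToComplCenter D hac k
  exact IsIso.of_isIso_comp_right _ (singularHomology.map ℤ ℤ (D.toComplCenter c₀) k)

omit [T2Space M] [SecondCountableTopology M] in
/-- **The boundary `M → W' ∖ {i 0}` induces isomorphisms on all `Hₖ(-; ℤ)`** (for `W'` simply
connected with `Hₖ(W'; ℤ) = 0`, `k ≥ 1`, `M` path connected with the integral homology of
`𝕊ᵐ⁺¹`): it is the bottom slice of a collar, homotopic to the slice `x ↦ κ (x, u)`
(`BoundaryCollar.sliceHomotopic`), which factors through the isomorphisms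
`M → X ∖ K → X ∖ {c} → W' ∖ {i 0}`. This proves, for this class of `(W', M)`, the conclusion of the
tree's named fact `NullCobordism.isIso_singularHomology_map_inclToComplCenter` (the "Poincaré
duality step" of `HomotopySpheresInverseHomotopy.lean`). [cite: KervaireMilnorAnnals1963, Lemma 2.3, proof (p. 506)] -/
theorem isIso_map_inclToComplCenter [SimplyConnectedSpace c₀.W] [PathConnectedSpace M]
    (hac : ∀ k, 1 ≤ k → IsZero (singularHomology ℤ ℤ c₀.W k))
    (hMtop : Nonempty (singularHomology ℤ ℤ M (m + 1) ≅ ModuleCat.of ℤ (ULift.{0} ℤ)))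
    (hMmid : ∀ k, 1 ≤ k → k ≠ m + 1 → IsZero (singularHomology ℤ ℤ M k)) (k : ℕ) :
    IsIso (singularHomology.map ℤ ℤ (D.inclToComplCenter c₀) k) := by
  obtain ⟨κ, hκ⟩ := c₀.exists_boundaryCollar
  obtain ⟨t, ht, hc⟩ := c₀.exists_level D hκ
  -- a level `u = t/2` strictly between `0` and `t`
  have ht' : (0 : ℝ) < t := ht
  let u : I := ⟨(t : ℝ) / 2, by constructor <;> linarith [t.2.2]⟩
  have hu : 0 < u := show (0 : ℝ) < t / 2 by linarith
  have hut : u < t := show (t : ℝ) / 2 < t by linarith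
  rw [c₀.inclToComplCenter_eq D hκ hc, singularHomology.map_eq_of_homotopic ℤ ℤ (κ.sliceHomotopic hut.le hc) k,
    ← c₀.slice_comp_eq D hκ hu hut hc, singularHomology.map_comp]
  haveI := c₀.isIso_map_sliceCompl D hac hMtop hMmid hκ hu hut (c₀.ctr_mem_coreInterior D hc) k
  haveI := c₀.isIso_map_valCompl D hκ ht hc k
  infer_instance

omit [T2Space M] [SecondCountableTopology M] in
/-- **The incoming end `M → K` of the ball-removal cobordism induces isomorphisms on all
`Hₖ(-; ℤ)`** (hypotheses as in `isIso_map_inclToComplCenter`; transport along `K ≃ W' ∖ {i 0}`,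
tree theorem `BallRemovalData.isIso_singularHomology_map_cobInlCM`). [cite: KervaireMilnorAnnals1963, Lemma 2.3, proof (p. 506)] -/
theorem isIso_map_inl_ballRemoval [SimplyConnectedSpace c₀.W] [PathConnectedSpace M]
    (hac : ∀ k, 1 ≤ k → IsZero (singularHomology ℤ ℤ c₀.W k))
    (hMtop : Nonempty (singularHomology ℤ ℤ M (m + 1) ≅ ModuleCat.of ℤ (ULift.{0} ℤ)))
    (hMmid : ∀ k, 1 ≤ k → k ≠ m + 1 → IsZero (singularHomology ℤ ℤ M k)) (k : ℕ) :
    IsIso (singularHomology.map ℤ ℤ (D.cobInlCM c₀) k) :=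
  D.isIso_singularHomology_map_cobInlCM c₀ (c₀.isIso_map_inclToComplCenter D hac hMtop hMmid) k

/-! ### Whitehead -/

/-- **Both ends of the ball-removal cobordism of an acyclic simply connected bounding manifold are
homotopy equivalences**, GIVEN Whitehead's theorem (Hatcher 2002, Cor. 4.33,
`whitehead_exists_homotopyEquiv`) and the CW homotopy type of manifolds (Milnor 1959, Cor. 1,
`Manifold.exists_cwComplex_homotopyEquiv`). Hypotheses: `M : Type` a closed simply connected smooth
`(m+1)`-manifold, `m ≥ 1`, with `Hₘ₊₁(M; ℤ) ≅ ℤ` and `Hₖ(M; ℤ) = 0` for `0 < k ≠ m + 1`; `W'` a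
null-cobordism of `M` which is simply connected with `Hₖ(W'; ℤ) = 0` for all `k ≥ 1`. The ends
induce isomorphisms on integral homology (`isIso_map_inl_ballRemoval`, `isIso_map_inr_ballRemoval`),
all three of `M`, `𝕊ᵐ⁺¹`, `K` are simply connected (`simplyConnectedSpace_k`) and have CW models
(`K ≃ₕ X ∖ {c}`, an open subset of the interior manifold `X`). This is the conclusion of
Kervaire–Milnor's Lemma 2.3 (1963, p. 506) for bounding manifolds with acyclic interior and
boundary a homology sphere, without Poincaré duality. [cite: KervaireMilnorAnnals1963, Lemma 2.3, proof (pp. 506–507)] [cite: HatcherAT2002, Cor. 4.33] [cite: Milnor1959, Cor. 1] -/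
theorem isHCobordism_ballRemoval_of_whitehead
    (hW : Literature.AlgebraicTopology.Homotopy.whitehead_exists_homotopyEquiv.{0})
    (hCW : Literature.AlgebraicTopology.Homotopy.Manifold.exists_cwComplex_homotopyEquiv.{0})
    [SimplyConnectedSpace c₀.W] [SimplyConnectedSpace M] (hm : 1 ≤ m)
    (hac : ∀ k, 1 ≤ k → IsZero (singularHomology ℤ ℤ c₀.W k))
    (hMtop : Nonempty (singularHomology ℤ ℤ M (m + 1) ≅ ModuleCat.of ℤ (ULift.{0} ℤ)))
    (hMmid : ∀ k, 1 ≤ k → k ≠ m + 1 → IsZero (singularHomology ℤ ℤ M k)) :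
    (D.cobordism c₀).IsHCobordism := by
  obtain ⟨κ, hκ⟩ := c₀.exists_boundaryCollar
  obtain ⟨t, ht, hc⟩ := c₀.exists_level D hκ
  -- CW models
  obtain ⟨P, _, _, _, -, ⟨eM⟩⟩ := hCW (m + 1) M
  haveI := Fact.mk (@finrank_euclideanSpace_fin ℝ _ (m + 1 + 1))
  obtain ⟨Q, _, _, _, -, ⟨eS⟩⟩ := hCW (m + 1) (𝕊 (m + 1))
  haveI : ChartedSpace (𝔼 (m + 1 + 1)) ↥(({c₀.ctr D}ᶜ : Set c₀.Interior)) :=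
    inferInstanceAs (ChartedSpace (𝔼 (m + 1 + 1))
      (⟨({c₀.ctr D}ᶜ : Set c₀.Interior), isOpen_compl_singleton⟩ : TopologicalSpace.Opens c₀.Interior))
  obtain ⟨C, _, _, _, -, ⟨eC⟩⟩ := hCW (m + 1 + 1) ↥(({c₀.ctr D}ᶜ : Set c₀.Interior))
  let eK : D.K ≃ₕ C := (c₀.kHomotopyEquiv D hκ ht hc).trans eC
  -- simple connectivity
  haveI := c₀.simplyConnectedSpace_k D hm
  haveI : SimplyConnectedSpace (𝕊 (m + 1)) := simplyConnectedSpace_euclideanSphere (by omega)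
  constructor
  · obtain ⟨e, he⟩ := Literature.AlgebraicTopology.Homotopy.exists_homotopyEquiv_of_isIso_map_of_homotopyEquiv_cwComplex
      hW eM eK (D.cobInlCM c₀)
      (c₀.isIso_map_inl_ballRemoval D hac hMtop hMmid)
    exact ⟨e, he⟩
  · obtain ⟨e, he⟩ := Literature.AlgebraicTopology.Homotopy.exists_homotopyEquiv_of_isIso_map_of_homotopyEquiv_cwComplex
      hW eS eK (D.cobInrCM c₀)
      (c₀.isIso_map_inr_ballRemoval D hac)
    exact ⟨e, he⟩

/-- **A simply connected integral homology `(m+1)`-sphere `M` (`m ≥ 1`) bounding a simply connected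
manifold `W'` with `Hₖ(W'; ℤ) = 0` for `k ≥ 1` is h-cobordant to `𝕊ᵐ⁺¹`**, GIVEN Whitehead's theorem
and the CW homotopy type of manifolds (Kervaire–Milnor 1963, Lemma 2.3, direction `⇐`, for this class
of `M`; the h-cobordism is `W' ∖ i(B̊)`). [cite: KervaireMilnorAnnals1963, Lemma 2.3 (p. 506)] -/
theorem isHCobordant_sphere_of_whitehead
    (hW : Literature.AlgebraicTopology.Homotopy.whitehead_exists_homotopyEquiv.{0})
    (hCW : Literature.AlgebraicTopology.Homotopy.Manifold.exists_cwComplex_homotopyEquiv.{0})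
    [SimplyConnectedSpace c₀.W] [SimplyConnectedSpace M] (hm : 1 ≤ m)
    (hac : ∀ k, 1 ≤ k → IsZero (singularHomology ℤ ℤ c₀.W k))
    (hMtop : Nonempty (singularHomology ℤ ℤ M (m + 1) ≅ ModuleCat.of ℤ (ULift.{0} ℤ)))
    (hMmid : ∀ k, 1 ≤ k → k ≠ m + 1 → IsZero (singularHomology ℤ ℤ M k)) :
    IsHCobordant (m + 1) M (𝕊 (m + 1)) := by
  obtain ⟨D⟩ := c₀.nonempty_ballRemovalData
  exact ⟨D.cobordism c₀, c₀.isHCobordism_ballRemoval_of_whitehead D hW hCW hm hac hMtop hMmid⟩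

end NullCobordism



end Literature.Topology.FourManifolds
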